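import Mathlib
import Summits.CriticalPhenomena.CardyFormulaZ2.Theorems.CardyWhiteToColouredDriftBoundPlackettDefs
import Summits.CriticalPhenomena.CardyFormulaZ2.Theorems.CardyWhiteToColouredDriftBoundStubSignLawSelfDual

/-!
# Plackett/Piterbarg drift identity for the noise heat flow: positivity of the variance

Helper file for crux item `DriftBound` (stmt-CriticalPhenomena-4596) of route `CardyWhiteToColoured`
(`CardyFormulaZ2`), line `registered` (skeleton v4, lead c3), sub-goal `pl_noiseVar_pos` used by the
stubs `stub_locality`, `stub_regLimit`, `stub_driftIdentity` (through `pl_normWeight_family`):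
for `σ > 0` the variance `noiseVar σ x = ∑' e, q_σ(x − m e)²` of the smoothed lattice white noise is
a convergent series of positive terms, hence positive, so the variance-normalised field `normNoise`
has the same signs as the field `smoothedNoise σ 1`.

References: S. Muirhead, H. Vanneuville, Ann. Inst. H. Poincaré Probab. Stat. 56 (2020), §2.1.
-/

noncomputable section

namespace Summit.CriticalPhenomena.CardyFormulaZ2.Cruxes.DriftBound.Birth

open MeasureTheory ProbabilityTheory Set
open Literature.Probability.LatticeModels Literature.Probability.Percolation

/-- The square of the Gaussian kernel is the Gaussian kernel at width `σ/√2`. -/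
theorem pl_gaussWeight_sq (σ : ℝ) (z : ℂ) : gaussWeight σ z ^ 2 = gaussWeight (σ / Real.sqrt 2) z := by
  unfold gaussWeight
  rw [← Real.exp_nat_mul]
  congr 1
  have h2 : Real.sqrt 2 ^ 2 = 2 := Real.sq_sqrt (by norm_num)
  rw [div_pow, h2]
  push_cast
  ring

/-- The edge set of `ℤ²` is nonempty (e.g. the edge `{0, e₀}`). -/
theorem pl_edgeSet_nonempty : Nonempty (zdGraph 2).edgeSet :=
  ⟨⟨s((0 : Site 2), (0 : Site 2) + Pi.single 0 1), mem_edgeSet_zdGraph_iff.2 ⟨0, 0, rfl⟩⟩⟩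

/-- For `σ > 0` the squared kernel is summable over the medial lattice at mesh `1`. -/
theorem pl_summable_gaussWeight_sq {σ : ℝ} (hσ : 0 < σ) (x : ℂ) :
    Summable fun e : (zdGraph 2).edgeSet => gaussWeight σ (x - medialPoint 1 e.1) ^ 2 := by
  simp_rw [pl_gaussWeight_sq]
  exact sd_summable_gaussWeight (div_pos hσ (Real.sqrt_pos.2 (by norm_num))) x

/-- For `σ > 0` the variance of the smoothed noise is positive. -/
theorem pl_noiseVar_pos' {σ : ℝ} (hσ : 0 < σ) (x : ℂ) : 0 < noiseVar σ x := by
  obtain ⟨e₀⟩ := pl_edgeSet_nonempty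
  unfold noiseVar
  exact (pl_summable_gaussWeight_sq hσ x).tsum_pos (fun e => sq_nonneg _) e₀
    (pow_pos (gaussWeight_pos _ _) 2)

/-- For `σ > 0`: the normalised field has the sign of the field. -/
theorem pl_normNoise_pos_iff {σ : ℝ} (hσ : 0 < σ) (ξ : (zdGraph 2).edgeSet → ℝ) (x : ℂ) :
    0 < normNoise σ ξ x ↔ 0 < smoothedNoise σ 1 ξ x := by
  unfold normNoise
  exact div_pos_iff_of_pos_right (Real.sqrt_pos.2 (pl_noiseVar_pos' hσ x))

/-- For `σ > 0`: the normalised field vanishes exactly where the field does. -/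
theorem pl_normNoise_ne_zero_iff {σ : ℝ} (hσ : 0 < σ) (ξ : (zdGraph 2).edgeSet → ℝ) (x : ℂ) :
    normNoise σ ξ x ≠ 0 ↔ smoothedNoise σ 1 ξ x ≠ 0 := by
  unfold normNoise
  rw [div_ne_zero_iff, and_iff_left]
  exact (Real.sqrt_pos.2 (pl_noiseVar_pos' hσ x)).ne'

/-- **Positivity of the variance (registered form).** For `σ > 0` and every point `x`, the series
`noiseVar σ x = ∑' e, q_σ(x − m e)²` converges and is positive, and consequently the normalised
field `normNoise σ ξ x` is positive iff the field `smoothedNoise σ 1 ξ x` is, and vanishes iff the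
field does. Fully qualified `∀`-form registered as a sub-goal stub of the crux item. -/
theorem pl_noiseVar_pos : ∀ (σ : ℝ) (x : ℂ), 0 < σ → 0 < Summit.CriticalPhenomena.CardyFormulaZ2.Cruxes.DriftBound.Birth.noiseVar σ x ∧ Summable (fun e : (Literature.Probability.LatticeModels.zdGraph 2).edgeSet => Literature.Probability.Percolation.gaussWeight σ (x - Literature.Probability.LatticeModels.medialPoint 1 e.1) ^ 2) ∧ ∀ ξ : (Literature.Probability.LatticeModels.zdGraph 2).edgeSet → ℝ, (0 < Summit.CriticalPhenomena.CardyFormulaZ2.Cruxes.DriftBound.Birth.normNoise σ ξ x ↔ 0 < Literature.Probability.Percolation.smoothedNoise σ 1 ξ x) ∧ (Summit.CriticalPhenomena.CardyFormulaZ2.Cruxes.DriftBound.Birth.normNoise σ ξ x ≠ 0 ↔ Literature.Probability.Percolation.smoothedNoise σ 1 ξ x ≠ 0) := by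
  intro σ x hσ
  exact ⟨pl_noiseVar_pos' hσ x, pl_summable_gaussWeight_sq hσ x,
    fun ξ => ⟨pl_normNoise_pos_iff hσ ξ x, pl_normNoise_ne_zero_iff hσ ξ x⟩⟩

end Summit.CriticalPhenomena.CardyFormulaZ2.Cruxes.DriftBound.Birth

end
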